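import Mathlib
import Summits.PneNP.PneNP.Theorems.CnfIdealGenLengthRankDefectRepresentationsTwoFamilyCutDomination

/-!
# Crux `RankDefectRepresentations` (stmt-PneNP-18923), line `rank-dehn-ladder`: ANCHOR EXTRAPOLATION (lead g11, RESHAPE 6,
# registered stub `stub_anchorExtrapolation`)

The first step of the ANCHOR METHOD for the two-dimensional max-cut decomposition (`DoubleMaxCutDecomposition`,
`Theorems/…TwoFamilyCutDomination`).  Rows and columns carry two colours (`colourI`, `colourJ`); an entry `(x,y)` is VISIBLE when both
colours differ.  A square minor `(X, Y)` is CO-RECTANGULAR if no row of `X` shares an I-colour or a J-colour with a column of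
`Y` — equivalently it lies inside one bi-separated rectangle `(B×B′)×(Bᶜ×B′ᶜ)`, whose rank is at most the double cut `doubleCut B B′`.
Take `r` maximal such that an INVERTIBLE co-rectangular `r`-minor `M = D[X₀,Y₀]` exists (`exists_maximal_anchor`); then `r ≤ c`
(`size_le_of_anchor`), and every co-rectangular `(r+1)`-minor is singular.  For a visible entry `(x,y)` whose row avoids the I- and
J-colours of the columns `Y₀` and whose column avoids the colours of the rows `X₀`, the bordered minor `D[X₀∪x, Y₀∪y]` is co-rectangular,
hence singular, and the Schur complement formula (`Matrix.det_fromBlocks₁₁`) gives `D x y = D[x,Y₀] · M⁻¹ · D[X₀,y]`.  So the rank-`r`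
matrix `F := G · M⁻¹ · H` (`G`, `H` = anchor columns / rows, zeroed on the colliding rows / columns) agrees with `D` at every visible
entry off four label strips of at most `c` colour classes each — the registered stub `stub_anchorExtrapolation`, proved here sorry-free.
Together with `stub_stripCompletion` it yields the class-independent quadratic bound `rank L ≤ c + 160c²`
(`doubleMaxCut_quadratic_of_stubs` in the skeleton `Cruxes/RankDefectRepresentations/Lines/rank_dehn_ladder.lean`).
HONEST FRAMING: elementary linear algebra; it does not close the crux or `stub_doubleMaxCutDecomposition` (which needs a bound linear
in `c`); P ≠ NP is not moved; F-N2 is a FRONTIER formal rung.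
-/

set_option linter.dupNamespace false -- `Summit.PneNP.PneNP.…`: summit = sub-problem name (D-0017)

namespace Summit.PneNP.PneNP.Theorems.CnfIdealGenLengthRankDefectRepresentationsAnchorExtrapolation

open Matrix
open Summit.PneNP.PneNP.Theorems.CnfIdealGenLengthRankDefectRepresentationsTwoFamilyCutDomination
  (colourI colourJ maskJ doubleCut)

variable {K : Type} [Field K] {n n' : ℕ} {ι ι' : Type} [Fintype ι] [Fintype ι'] [DecidableEq ι] [DecidableEq ι']

section Anchors

variable (row : ι → Fin n ⊕ Fin n' → Bool) (col : ι' → Fin n ⊕ Fin n' → Bool) (D : Matrix ι ι' K)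

omit [Fintype ι'] [DecidableEq ι] [DecidableEq ι'] in
/-- An invertible minor has pairwise distinct rows, hence at most `card ι` of them. -/
theorem le_card_of_isUnit_det {k : ℕ} (X : Fin k → ι) (Y : Fin k → ι') (hu : IsUnit (D.submatrix X Y).det) :
    k ≤ Fintype.card ι := by
  have hinj : Function.Injective X := by
    intro i i' hii'
    by_contra hne
    have hz : (D.submatrix X Y).det = 0 :=
      Matrix.det_zero_of_row_eq hne (by ext j; simp [Matrix.submatrix_apply, hii'])
    rw [hz] at hu
    exact not_isUnit_zero hu
  simpa using Fintype.card_le_of_injective X hinj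

omit [Fintype ι'] [DecidableEq ι] [DecidableEq ι'] in
/-- **A maximal anchor exists**: an invertible CO-RECTANGULAR minor `(X, Y)` (no row of it shares an I-colour or a J-colour with a
column of it) of some size `r` such that no invertible co-rectangular minor of size `r + 1` exists.  (The empty minor is an anchor and
sizes are bounded by `card ι`, so `Nat.findGreatest` applies.) -/
theorem exists_maximal_anchor :
    ∃ (r : ℕ) (X : Fin r → ι) (Y : Fin r → ι'),
      (∀ i j, colourI (row (X i)) ≠ colourI (col (Y j)) ∧ colourJ (row (X i)) ≠ colourJ (col (Y j))) ∧
      IsUnit (D.submatrix X Y).det ∧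
      ∀ (X' : Fin (r + 1) → ι) (Y' : Fin (r + 1) → ι'),
        (∀ i j, colourI (row (X' i)) ≠ colourI (col (Y' j)) ∧ colourJ (row (X' i)) ≠ colourJ (col (Y' j))) →
        ¬ IsUnit (D.submatrix X' Y').det := by
  classical
  let P : ℕ → Prop := fun k => ∃ (X : Fin k → ι) (Y : Fin k → ι'),
    (∀ i j, colourI (row (X i)) ≠ colourI (col (Y j)) ∧ colourJ (row (X i)) ≠ colourJ (col (Y j))) ∧
    IsUnit (D.submatrix X Y).det
  have hP0 : P 0 := ⟨Fin.elim0, Fin.elim0, fun i => i.elim0, by rw [Matrix.det_fin_zero]; exact isUnit_one⟩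
  have hPle : ∀ k, P k → k ≤ Fintype.card ι := fun k ⟨X, Y, _, hu⟩ => le_card_of_isUnit_det D X Y hu
  obtain ⟨X, Y, hco, hu⟩ : P (Nat.findGreatest P (Fintype.card ι)) := Nat.findGreatest_spec (P := P) (Nat.zero_le _) hP0
  refine ⟨Nat.findGreatest P (Fintype.card ι), X, Y, hco, hu, fun X' Y' hco' hu' => ?_⟩
  have hP' : P (Nat.findGreatest P (Fintype.card ι) + 1) := ⟨X', Y', hco', hu'⟩
  exact Nat.findGreatest_is_greatest (Nat.lt_succ_self _) (hPle _ hP') hP'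

/-- **An invertible co-rectangular minor sits inside a bi-separated rectangle, so its size is at most the double-cut bound.** -/
theorem size_le_of_anchor {k : ℕ} {X : Fin k → ι} {Y : Fin k → ι'}
    (hco : ∀ i j, colourI (row (X i)) ≠ colourI (col (Y j)) ∧ colourJ (row (X i)) ≠ colourJ (col (Y j)))
    (hu : IsUnit (D.submatrix X Y).det) {c : ℕ} (hc : ∀ B B', doubleCut row col B B' D ≤ c) : k ≤ c := by
  classical
  set B : Finset (Fin n → Bool) := Finset.univ.image fun i => colourI (row (X i)) with hB
  set B' : Finset (Fin n' → Bool) := Finset.univ.image fun i => colourJ (row (X i)) with hB'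
  set M₁ : Matrix ι ι' K :=
    Matrix.of fun x y => if colourI (row x) ∈ B ∧ colourI (col y) ∉ B then maskJ row col B' D x y else 0 with hM₁
  -- the minor is a selection of `M₁`
  set P : Matrix (Fin k) ι K := Matrix.of fun i x => if x = X i then (1 : K) else 0 with hP
  set Q : Matrix ι' (Fin k) K := Matrix.of fun y j => if y = Y j then (1 : K) else 0 with hQ
  have hrowB : ∀ i, colourI (row (X i)) ∈ B := fun i => Finset.mem_image.2 ⟨i, Finset.mem_univ _, rfl⟩
  have hrowB' : ∀ i, colourJ (row (X i)) ∈ B' := fun i => Finset.mem_image.2 ⟨i, Finset.mem_univ _, rfl⟩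
  have hcolB : ∀ j, colourI (col (Y j)) ∉ B := by
    intro j hj
    obtain ⟨i, -, hi⟩ := Finset.mem_image.1 hj
    exact (hco i j).1 hi
  have hcolB' : ∀ j, colourJ (col (Y j)) ∉ B' := by
    intro j hj
    obtain ⟨i, -, hi⟩ := Finset.mem_image.1 hj
    exact (hco i j).2 hi
  have hentry : ∀ i j, M₁ (X i) (Y j) = D (X i) (Y j) := by
    intro i j
    have h1 := hrowB i
    have h2 := hcolB j
    have h3 := hrowB' i
    have h4 := hcolB' j
    simp only [hM₁, maskJ, Matrix.of_apply, h1, h2, h3, h4, not_false_eq_true, and_self, if_true]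
    simp
  have hPM : ∀ i y, (P * M₁) i y = M₁ (X i) y := by
    intro i y
    simp only [Matrix.mul_apply, hP, Matrix.of_apply, ite_mul, one_mul, zero_mul]
    rw [Finset.sum_ite_eq' Finset.univ (X i)]
    simp
  have hPMQ : ∀ i j y, (P * M₁) i y * Q y j = if y = Y j then M₁ (X i) y else 0 := by
    intro i j y
    rw [hPM i y]
    simp only [hQ, Matrix.of_apply, mul_ite, mul_one, mul_zero]
  have hsel : D.submatrix X Y = P * M₁ * Q := by
    ext i j
    rw [Matrix.mul_apply, Finset.sum_congr rfl fun y _ => hPMQ i j y, Finset.sum_ite_eq' Finset.univ (Y j)]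
    simp [hentry]
  have hrank : (D.submatrix X Y).rank = k := by
    rw [Matrix.rank_of_isUnit _ ((Matrix.isUnit_iff_isUnit_det _).2 hu), Fintype.card_fin]
  have hle : (D.submatrix X Y).rank ≤ M₁.rank := by
    rw [hsel]
    exact (Matrix.rank_mul_le_left _ _).trans (Matrix.rank_mul_le_right _ _)
  have hM₁le : M₁.rank ≤ doubleCut row col B B' D := by
    unfold doubleCut
    exact Nat.le_add_right _ _
  calc k = (D.submatrix X Y).rank := hrank.symm
    _ ≤ M₁.rank := hle
    _ ≤ doubleCut row col B B' D := hM₁le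
    _ ≤ c := hc B B'

end Anchors

/-- **ANCHOR EXTRAPOLATION** (registered stub `stub_anchorExtrapolation` of `Lines/rank_dehn_ladder.lean`, RESHAPE 6): if all double
bipartition cuts of `D` are `≤ c`, there are a matrix `F` of rank `≤ c` and four label sets `PI, PI′` (first family), `QJ, QJ′`
(second family), each of size `≤ c`, such that `F` agrees with `D` at every visible entry whose row has I-colour `∉ PI` and J-colour
`∉ QJ` and whose column has I-colour `∉ PI′` and J-colour `∉ QJ′`. -/
theorem stub_anchorExtrapolation :
    ∀ (K : Type) [Field K] (n n' : ℕ) (ι ι' : Type) [Fintype ι] [Fintype ι'] [DecidableEq ι] [DecidableEq ι']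
      (row : ι → Fin n ⊕ Fin n' → Bool) (col : ι' → Fin n ⊕ Fin n' → Bool) (D : Matrix ι ι' K) (c : ℕ),
      (∀ B B', doubleCut row col B B' D ≤ c) →
      ∃ (F : Matrix ι ι' K) (PI PI' : Finset (Fin n → Bool)) (QJ QJ' : Finset (Fin n' → Bool)),
        F.rank ≤ c ∧ PI.card ≤ c ∧ PI'.card ≤ c ∧ QJ.card ≤ c ∧ QJ'.card ≤ c ∧
        ∀ x y, colourI (row x) ≠ colourI (col y) → colourJ (row x) ≠ colourJ (col y) →
          colourI (row x) ∉ PI → colourJ (row x) ∉ QJ → colourI (col y) ∉ PI' → colourJ (col y) ∉ QJ' →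
          F x y = D x y := by
  intro K _ n n' ι ι' _ _ _ _ row col D c hc
  classical
  obtain ⟨r, X, Y, hco, hu, hmax⟩ := exists_maximal_anchor row col D
  have hrc : r ≤ c := size_le_of_anchor row col D hco hu hc
  -- the anchor, its inverse, the good rows / columns and the extrapolation `F = G * M⁻¹ * H`
  set M : Matrix (Fin r) (Fin r) K := D.submatrix X Y with hM
  let goodRow : ι → Prop := fun x => ∀ j, colourI (row x) ≠ colourI (col (Y j)) ∧ colourJ (row x) ≠ colourJ (col (Y j))
  let goodCol : ι' → Prop := fun y => ∀ i, colourI (row (X i)) ≠ colourI (col y) ∧ colourJ (row (X i)) ≠ colourJ (col y)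
  set G : Matrix ι (Fin r) K := Matrix.of fun x j => if goodRow x then D x (Y j) else 0 with hG
  set H : Matrix (Fin r) ι' K := Matrix.of fun i y => if goodCol y then D (X i) y else 0 with hH
  set PI : Finset (Fin n → Bool) := Finset.univ.image fun j => colourI (col (Y j)) with hPI
  set QJ : Finset (Fin n' → Bool) := Finset.univ.image fun j => colourJ (col (Y j)) with hQJ
  set PI' : Finset (Fin n → Bool) := Finset.univ.image fun i => colourI (row (X i)) with hPI'
  set QJ' : Finset (Fin n' → Bool) := Finset.univ.image fun i => colourJ (row (X i)) with hQJ'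
  have hcard : ∀ {α : Type} [DecidableEq α] (f : Fin r → α), (Finset.univ.image f).card ≤ c := by
    intro α _ f
    exact Finset.card_image_le.trans (by rw [Finset.card_univ, Fintype.card_fin]; exact hrc)
  refine ⟨G * M⁻¹ * H, PI, PI', QJ, QJ', ?_, hcard _, hcard _, hcard _, hcard _, ?_⟩
  · -- rank F ≤ r ≤ c
    calc (G * M⁻¹ * H).rank ≤ (G * M⁻¹).rank := Matrix.rank_mul_le_left _ _
      _ ≤ G.rank := Matrix.rank_mul_le_left _ _
      _ ≤ Fintype.card (Fin r) := Matrix.rank_le_card_width _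
      _ = r := Fintype.card_fin r
      _ ≤ c := hrc
  · intro x y hvisI hvisJ hxPI hxQJ hyPI' hyQJ'
    -- the row `x` and the column `y` are good
    have hgx : goodRow x := by
      intro j
      refine ⟨fun h => hxPI (Finset.mem_image.2 ⟨j, Finset.mem_univ _, h.symm⟩),
        fun h => hxQJ (Finset.mem_image.2 ⟨j, Finset.mem_univ _, h.symm⟩)⟩
    have hgy : goodCol y := by
      intro i
      refine ⟨fun h => hyPI' (Finset.mem_image.2 ⟨i, Finset.mem_univ _, h⟩),
        fun h => hyQJ' (Finset.mem_image.2 ⟨i, Finset.mem_univ _, h⟩)⟩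
    -- the bordered minor
    set X' : Fin r ⊕ Fin 1 → ι := Sum.elim X (fun _ => x) with hX'
    set Y' : Fin r ⊕ Fin 1 → ι' := Sum.elim Y (fun _ => y) with hY'
    set Bc : Matrix (Fin r) (Fin 1) K := Matrix.of fun i _ => D (X i) y with hBc
    set Cr : Matrix (Fin 1) (Fin r) K := Matrix.of fun _ j => D x (Y j) with hCr
    set Dd : Matrix (Fin 1) (Fin 1) K := Matrix.of fun _ _ => D x y with hDd
    have hblocks : D.submatrix X' Y' = Matrix.fromBlocks M Bc Cr Dd := by
      ext (i | u) (j | v) <;> rfl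
    -- it is co-rectangular, hence (maximality of `r`) singular
    have hco' : ∀ a b, colourI (row (X' a)) ≠ colourI (col (Y' b)) ∧ colourJ (row (X' a)) ≠ colourJ (col (Y' b)) := by
      rintro (i | u) (j | v)
      · exact hco i j
      · exact hgy i
      · exact hgx j
      · exact ⟨hvisI, hvisJ⟩
    have hsing : (D.submatrix X' Y').det = 0 := by
      by_contra hne
      let e : Fin (r + 1) ≃ Fin r ⊕ Fin 1 := finSumFinEquiv.symm
      have hdet : (D.submatrix (X' ∘ e) (Y' ∘ e)).det = (D.submatrix X' Y').det := by
        rw [show D.submatrix (X' ∘ e) (Y' ∘ e) = (D.submatrix X' Y').submatrix e e from rfl,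
          Matrix.det_submatrix_equiv_self]
      refine hmax (X' ∘ e) (Y' ∘ e) (fun a b => hco' (e a) (e b)) ?_
      rw [hdet]
      exact isUnit_iff_ne_zero.2 hne
    -- Schur complement
    haveI : Invertible M := Matrix.invertibleOfIsUnitDet M hu
    rw [hblocks, Matrix.det_fromBlocks₁₁] at hsing
    have hdetM : M.det ≠ 0 := hu.ne_zero
    have hschur : (Dd - Cr * ⅟M * Bc).det = 0 := by
      rcases mul_eq_zero.1 hsing with h | h
      · exact (hdetM h).elim
      · exact h
    rw [Matrix.det_unique] at hschur
    have hentry : D x y = (Cr * ⅟M * Bc) default default := by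
      have := hschur
      rw [Matrix.sub_apply] at this
      have hDd0 : Dd default default = D x y := rfl
      rw [hDd0] at this
      exact (sub_eq_zero.1 this)
    -- compare with `(G * M⁻¹ * H) x y`
    rw [hentry, Matrix.invOf_eq_nonsing_inv]
    simp only [Matrix.mul_apply]
    refine Finset.sum_congr rfl fun i _ => ?_
    have hHi : H i y = D (X i) y := by simp only [hH, Matrix.of_apply, if_pos hgy]
    have hBci : Bc i default = D (X i) y := rfl
    rw [hHi, hBci]
    congr 1
    refine Finset.sum_congr rfl fun j _ => ?_
    have hGj : G x j = D x (Y j) := by simp only [hG, Matrix.of_apply, if_pos hgx]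
    have hCrj : Cr default j = D x (Y j) := rfl
    rw [hGj, hCrj]

end Summit.PneNP.PneNP.Theorems.CnfIdealGenLengthRankDefectRepresentationsAnchorExtrapolation
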